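import Literature.NumberTheory.Sieve.QuadraticRootsPrimeModuliDFIBilinearCauchy
import Literature.NumberTheory.Sieve.QuadraticRootsPrimeModuliDFISmoothing
import Literature.NumberTheory.Sieve.QuadraticRootsPrimeModuliDFIRhoSums
import HarnessLib

/-!
# Duke–Friedlander–Iwaniec 1995, §5: the sums `B_{n₁n₂}(M)` (diagonal and off-diagonal)

Topic `Literature/NumberTheory/Sieve`.  Seventh file of the deduction of DFI's Propositions 1–2
from Proposition 4 (W. Duke, J. B. Friedlander, H. Iwaniec, Ann. of Math. 141 (1995), §5
p. 433).  For a real weight `g` vanishing off `[M', 2M']` and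
`B^{g}_{n₁n₂} = ∑_{(m, n₁n₂) = 1} g(m) fibrePairSum(m; n₁, n₂)` (the inner sums of the master
inequality `DFI1995.norm_bilinearForm_sq_le_master`), this file PROVES, for
`f = aX² + 2bX + c`, `ac − b² > 0`:

* `DFI1995.exists_norm_diag_weight_le` — "For `n₁ = n₂` we shall use the trivial bound
  `B_{nn}(M) ≪ M`": `|B^{g}_{nn}| ≤ C_f M'` for `n` prime and `|g| ≤ 1`
  (`|fibrePairSum(m; n, n)| ≤ ρ(m)ρ(n)²`, `ρ(n) ≤ B_f`, `∑_{m ≤ 2M'} ρ(m) ≤ C_f M'`);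
* `DFI1995.exists_norm_offdiag_weight_le` — for distinct primes `n₁, n₂`: "`m, n₁, n₂` are
  pairwise co-prime so we can write `B_{n₁n₂}(M) = ∑ … e(ν(n₂ − n₁)h/mn₁n₂)`.  Here, the condition
  `(m, n₁n₂) = 1` can be removed at the cost of two error terms bounded trivially by
  `4∑_{m ≡ 0 (n_j)} g(m)ρ(m) ≪ N^{−1}M` … The resulting sum is now recognized to be exactly
  `L*_{n₁n₂}(M)` with `h` replaced by `(n₂ − n₁)h`.  Hence, provided `N² ≪ M`, (25) is applicable":
  for `g ∈ C⁴`, `|g^{(j)}| ≤ M'^{−j}`, `n₁n₂ ≤ C₁M'`, `h|n₂ − n₁| ≤ C₂ n₁n₂ M'`,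
  `|B^{g}_{n₁n₂}| ≤ K (τ(h''d)^{3/2} (h'', d)^{1/4} d^{1/4} M'^{3/4} log 2M' + M'/n₁ + M'/n₂)`,
  `d = n₁n₂`, `h'' = h|n₂ − n₁|` ((25) = `DFI1995.smoothLinear_le_of_proposition4`, the error
  terms by `DFI1995.exists_sum_rho_offdiag_le_quad`).
  [cite: DukeFriedlanderIwaniec1995, §5 p. 433]

Proposition 4 enters only as the hypothesis `H4`; no new named fact is introduced.

## References

* W. Duke, J. B. Friedlander, H. Iwaniec, Ann. of Math. (2) 141 (1995), 423–441, §5 p. 433.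
  [cite: DukeFriedlanderIwaniec1995, §5 p. 433]
-/

noncomputable section

namespace Literature.NumberTheory.Sieve

open scoped BigOperators Polynomial ComplexConjugate
open Finset Polynomial

namespace DFI1995

/-! ### Restricting weighted sums to the support of the weight -/

/-- If `g` vanishes above `2M'` and `2M' ≤ X`, a `g`-weighted sum over `m ≤ X` is a sum over
`m ≤ 2M'`. [folklore] -/
theorem sum_filter_weight_restrict {g : ℝ → ℝ} {M' X : ℝ} (hX : 2 * M' ≤ X)
    (hsupp : ∀ t : ℝ, g t ≠ 0 → M' ≤ t ∧ t ≤ 2 * M') (p : ℕ → Prop) [DecidablePred p]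
    (T : ℕ → ℂ) :
    ∑ m ∈ (Icc 1 ⌊X⌋₊).filter p, (g m : ℂ) * T m =
      ∑ m ∈ (Icc 1 ⌊2 * M'⌋₊).filter p, (g m : ℂ) * T m := by
  symm
  refine Finset.sum_subset ?_ ?_
  · intro m hm
    rw [Finset.mem_filter, Finset.mem_Icc] at hm ⊢
    exact ⟨⟨hm.1.1, hm.1.2.trans (Nat.floor_le_floor hX)⟩, hm.2⟩
  · intro m hm hm'
    rw [Finset.mem_filter, Finset.mem_Icc] at hm hm'
    have hgt : 2 * M' < (m : ℝ) := by
      by_contra hle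
      exact hm' ⟨⟨hm.1.1, Nat.le_floor (not_lt.1 hle)⟩, hm.2⟩
    have hg : g m = 0 := by
      by_contra hne
      exact absurd (hsupp _ hne).2 (not_le.2 hgt)
    rw [hg, Complex.ofReal_zero, zero_mul]

/-! ### The diagonal `n₁ = n₂` -/

/-- **"For `n₁ = n₂` we shall use the trivial bound `B_{nn}(M) ≪ M`"** (p. 433): for DFI's `f`
there is `C` such that for every real weight `|g| ≤ 1` vanishing off `[M', 2M']` (`M' ≥ 0`,
`2M' ≤ X`), every integer `h` and every prime `n`,
`|∑_{m ≤ X, (m,n)=1} g(m) fibrePairSum(m; n, n)| ≤ C M'`. [cite: DukeFriedlanderIwaniec1995, §5 p. 433] -/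
theorem exists_norm_diag_weight_le {a b c : ℤ} (hD : 0 < a * c - b ^ 2) :
    ∃ C : ℝ, 0 < C ∧ ∀ (g : ℝ → ℝ) (M' X : ℝ), 0 ≤ M' → 2 * M' ≤ X → (∀ t : ℝ, |g t| ≤ 1) →
      (∀ t : ℝ, g t ≠ 0 → M' ≤ t ∧ t ≤ 2 * M') → ∀ (h : ℤ) (n : ℕ), n.Prime →
      ‖∑ m ∈ (Icc 1 ⌊X⌋₊).filter (fun m => Nat.Coprime m n ∧ Nat.Coprime m n),
        (g m : ℂ) * fibrePairSum (quad a b c) h m n n‖ ≤ C * M' := by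
  obtain ⟨B, hB1, hB⟩ := exists_rho_primePow_le_quad hD
  obtain ⟨C₀, hC₀, hmv⟩ := exists_sum_rho_le_quad hD
  refine ⟨2 * B ^ 2 * C₀, by positivity, ?_⟩
  intro g M' X hM' hX hg1 hsupp h n hn
  rw [sum_filter_weight_restrict hX hsupp]
  have hρn : (polyRootCountMod ![quad a b c] n : ℝ) ≤ B := by
    have := hB n 1 hn
    rwa [pow_one] at this
  refine (norm_sum_le _ _).trans ?_
  have hterm : ∀ m ∈ (Icc 1 ⌊2 * M'⌋₊).filter (fun m => Nat.Coprime m n ∧ Nat.Coprime m n),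
      ‖(g m : ℂ) * fibrePairSum (quad a b c) h m n n‖ ≤
        B ^ 2 * (polyRootCountMod ![quad a b c] m : ℝ) := by
    intro m hm
    rw [Finset.mem_filter, Finset.mem_Icc] at hm
    rw [norm_mul, Complex.norm_real, Real.norm_eq_abs]
    have h1 := norm_fibrePairSum_diag_le (quad a b c) h (m := m) (n := n) (by omega) hn.pos hm.2.1
    have hρ0 : (0 : ℝ) ≤ polyRootCountMod ![quad a b c] n := Nat.cast_nonneg _
    calc |g m| * ‖fibrePairSum (quad a b c) h m n n‖
        ≤ 1 * ((polyRootCountMod ![quad a b c] m : ℝ) * (polyRootCountMod ![quad a b c] n : ℝ) ^ 2) :=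
          mul_le_mul (hg1 _) h1 (norm_nonneg _) zero_le_one
      _ ≤ 1 * ((polyRootCountMod ![quad a b c] m : ℝ) * B ^ 2) := by
          gcongr
      _ = B ^ 2 * (polyRootCountMod ![quad a b c] m : ℝ) := by ring
  refine (Finset.sum_le_sum hterm).trans ?_
  rw [← Finset.mul_sum]
  calc B ^ 2 * ∑ m ∈ (Icc 1 ⌊2 * M'⌋₊).filter (fun m => Nat.Coprime m n ∧ Nat.Coprime m n),
        (polyRootCountMod ![quad a b c] m : ℝ)
      ≤ B ^ 2 * ∑ m ∈ Icc 1 ⌊2 * M'⌋₊, (polyRootCountMod ![quad a b c] m : ℝ) := by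
        refine mul_le_mul_of_nonneg_left ?_ (by positivity)
        exact Finset.sum_le_sum_of_subset_of_nonneg (Finset.filter_subset _ _) fun _ _ _ => Nat.cast_nonneg _
    _ ≤ B ^ 2 * (C₀ * (2 * M')) := mul_le_mul_of_nonneg_left (hmv _ (by positivity)) (by positivity)
    _ = 2 * B ^ 2 * C₀ * M' := by ring

/-! ### The off-diagonal `n₁ ≠ n₂` -/

/-- For a real weight, replacing `h` by `−h` conjugates the smoothed linear form. [folklore] -/
theorem norm_sum_polyRootWeylSum_neg (f : ℤ[X]) (S : Finset ℕ) (d : ℕ) (k : ℤ) (g : ℝ → ℝ) :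
    ‖∑ m ∈ S, polyRootWeylSum f (d * m) (-k) * (g m : ℂ)‖ =
      ‖∑ m ∈ S, polyRootWeylSum f (d * m) k * (g m : ℂ)‖ := by
  have : ∑ m ∈ S, polyRootWeylSum f (d * m) (-k) * (g m : ℂ) =
      conj (∑ m ∈ S, polyRootWeylSum f (d * m) k * (g m : ℂ)) := by
    rw [map_sum]
    refine Finset.sum_congr rfl fun m _ => ?_
    rw [map_mul, Complex.conj_ofReal, polyRootWeylSum_neg]
  rw [this, Complex.norm_conj]

/-- Non-coprimality with two primes. [folklore] -/
theorem dvd_or_dvd_of_not_coprime {m n₁ n₂ : ℕ} (h₁ : n₁.Prime) (h₂ : n₂.Prime)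
    (h : ¬ (Nat.Coprime m n₁ ∧ Nat.Coprime m n₂)) : n₁ ∣ m ∨ n₂ ∣ m := by
  by_contra hcon
  rw [not_or] at hcon
  exact h ⟨((Nat.Prime.coprime_iff_not_dvd h₁).2 hcon.1).symm,
    ((Nat.Prime.coprime_iff_not_dvd h₂).2 hcon.2).symm⟩

/-- **The off-diagonal sums** (p. 433, quoted in the module docstring): with `K` depending on
`f, C₁, C₂` only, for every `C⁴` weight `g` vanishing off `[M', 2M']` (`M' ≥ 1`, `2M' ≤ X`) with
`|g^{(j)}| ≤ M'^{−j}` (`j ≤ 4`), every `h ≥ 1` and all primes `n₁ ≠ n₂` with `n₁n₂ ≤ C₁M'` and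
`h|n₂ − n₁| ≤ C₂ n₁n₂ M'`:
`|∑_{m ≤ X, (m,n₁)=(m,n₂)=1} g(m) fibrePairSum(m; n₁, n₂)| ≤ K (τ(h''d)^{3/2} (h'',d)^{1/4} d^{1/4} M'^{3/4} log 2M' + M'/n₁ + M'/n₂)`,
`d = n₁n₂`, `h'' = h|n₂ − n₁|`. [cite: DukeFriedlanderIwaniec1995, §5 p. 433] -/
theorem exists_norm_offdiag_weight_le (H4 : dukeFriedlanderIwaniec1995_proposition4)
    {a b c : ℤ} (hD : 0 < a * c - b ^ 2) {C₁ C₂ : ℝ} (hC₁ : 0 < C₁) (hC₂ : 0 < C₂) :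
    ∃ K : ℝ, 0 < K ∧ ∀ (g : ℝ → ℝ) (M' X : ℝ), 1 ≤ M' → 2 * M' ≤ X → ContDiff ℝ 4 g →
      (∀ t : ℝ, g t ≠ 0 → M' ≤ t ∧ t ≤ 2 * M') →
      (∀ j : ℕ, j ≤ 4 → ∀ t : ℝ, |iteratedDeriv j g t| ≤ M' ^ (-(j : ℝ))) →
      ∀ h : ℕ, 1 ≤ h → ∀ n₁ n₂ : ℕ, n₁.Prime → n₂.Prime → n₁ ≠ n₂ →
      ((n₁ * n₂ : ℕ) : ℝ) ≤ C₁ * M' →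
      ((h * Int.natAbs ((n₂ : ℤ) - n₁) : ℕ) : ℝ) ≤ C₂ * ((n₁ * n₂ : ℕ) : ℝ) * M' →
      ‖∑ m ∈ (Icc 1 ⌊X⌋₊).filter (fun m => Nat.Coprime m n₁ ∧ Nat.Coprime m n₂),
        (g m : ℂ) * fibrePairSum (quad a b c) h m n₁ n₂‖ ≤
        K * (((Nat.divisors (h * Int.natAbs ((n₂ : ℤ) - n₁) * (n₁ * n₂))).card : ℝ) ^ (3 / 2 : ℝ) *
              (Nat.gcd (h * Int.natAbs ((n₂ : ℤ) - n₁)) (n₁ * n₂) : ℝ) ^ (1 / 4 : ℝ) *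
              ((n₁ * n₂ : ℕ) : ℝ) ^ (1 / 4 : ℝ) * M' ^ (3 / 4 : ℝ) * Real.log (2 * M') +
            M' / n₁ + M' / n₂) := by
  obtain ⟨K₂₅, hK₂₅, h25⟩ := smoothLinear_le_of_proposition4 H4 hD hC₁ hC₂
  obtain ⟨Ce, hCe, herr⟩ := exists_sum_rho_offdiag_le_quad hD
  refine ⟨max K₂₅ (2 * Ce), lt_max_of_lt_left hK₂₅, ?_⟩
  intro g M' X hM' hX hg hsupp hder h hh n₁ n₂ hp₁ hp₂ hne hd hfreq
  set f : ℤ[X] := quad a b c with hf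
  set d : ℕ := n₁ * n₂ with hdd
  set k : ℕ := h * Int.natAbs ((n₂ : ℤ) - n₁) with hk
  have hM'0 : 0 < M' := by linarith
  have hn₁ : 0 < n₁ := hp₁.pos
  have hn₂ : 0 < n₂ := hp₂.pos
  have hd1 : 1 ≤ d := Nat.one_le_iff_ne_zero.2 (Nat.mul_ne_zero hn₁.ne' hn₂.ne')
  have h12 : n₁.Coprime n₂ := (Nat.coprime_primes hp₁ hp₂).2 hne
  have hk1 : 1 ≤ k := by
    rw [hk]
    refine Nat.one_le_iff_ne_zero.2 (Nat.mul_ne_zero (by omega) ?_)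
    rw [Ne, Int.natAbs_eq_zero, sub_eq_zero]
    exact_mod_cast hne.symm
  -- `|g| ≤ 1`
  have hg1 : ∀ t : ℝ, |g t| ≤ 1 := by
    intro t
    have := hder 0 (by norm_num) t
    simpa using this
  rw [sum_filter_weight_restrict hX hsupp]
  -- the coprime terms: `fibrePairSum = ρ_{h(n₂-n₁)}(d m)`
  set k' : ℤ := (h : ℤ) * ((n₂ : ℤ) - (n₁ : ℤ)) with hk'
  have hY : ∀ m ∈ (Icc 1 ⌊2 * M'⌋₊).filter (fun m => Nat.Coprime m n₁ ∧ Nat.Coprime m n₂),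
      (g m : ℂ) * fibrePairSum f h m n₁ n₂ = polyRootWeylSum f (d * m) k' * (g m : ℂ) := by
    intro m hm
    rw [Finset.mem_filter, Finset.mem_Icc] at hm
    rw [fibrePairSum_eq_polyRootWeylSum f h (by omega) hn₁ hn₂ hm.2.2 h12, hdd,
      show m * n₁ * n₂ = n₁ * n₂ * m by ring, mul_comm]
  rw [Finset.sum_congr rfl hY]
  -- add back the non-coprime terms
  have hsplit := Finset.sum_filter_add_sum_filter_not (Icc 1 ⌊2 * M'⌋₊)
    (fun m => Nat.Coprime m n₁ ∧ Nat.Coprime m n₂) (fun m => polyRootWeylSum f (d * m) k' * (g m : ℂ))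
  have heq : ∑ m ∈ (Icc 1 ⌊2 * M'⌋₊).filter (fun m => Nat.Coprime m n₁ ∧ Nat.Coprime m n₂),
      polyRootWeylSum f (d * m) k' * (g m : ℂ) =
      ∑ m ∈ Icc 1 ⌊2 * M'⌋₊, polyRootWeylSum f (d * m) k' * (g m : ℂ) -
      ∑ m ∈ (Icc 1 ⌊2 * M'⌋₊).filter (fun m => ¬ (Nat.Coprime m n₁ ∧ Nat.Coprime m n₂)),
        polyRootWeylSum f (d * m) k' * (g m : ℂ) := by
    rw [← hsplit]; ring
  rw [heq]
  refine (norm_sub_le _ _).trans ?_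
  -- the full sum: (25) with frequency `k = |k'|`
  have hfull : ‖∑ m ∈ Icc 1 ⌊2 * M'⌋₊, polyRootWeylSum f (d * m) k' * (g m : ℂ)‖ ≤
      K₂₅ * ((Nat.divisors (k * d)).card : ℝ) ^ (3 / 2 : ℝ) * (Nat.gcd k d : ℝ) ^ (1 / 4 : ℝ) *
        (d : ℝ) ^ (1 / 4 : ℝ) * M' ^ (3 / 4 : ℝ) * Real.log (2 * M') := by
    have h25' := h25 k hk1 d hd1 M' hM' hd hfreq g hg hsupp hder
    -- `k' = ± k`
    have hk'abs : k' = (k : ℤ) ∨ k' = -(k : ℤ) := by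
      rw [hk', hk]
      push_cast
      rcases le_or_gt (n₁ : ℤ) n₂ with hle | hlt
      · left
        rw [abs_of_nonneg (by linarith)]
      · right
        rw [abs_of_neg (by linarith)]
        ring
    rcases hk'abs with h1 | h1
    · rw [h1]; exact h25'
    · rw [h1, norm_sum_polyRootWeylSum_neg]; exact h25'
  -- the error terms
  have herr' : ‖∑ m ∈ (Icc 1 ⌊2 * M'⌋₊).filter (fun m => ¬ (Nat.Coprime m n₁ ∧ Nat.Coprime m n₂)),
      polyRootWeylSum f (d * m) k' * (g m : ℂ)‖ ≤ 2 * Ce * (M' / n₁ + M' / n₂) := by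
    refine (norm_sum_le _ _).trans ?_
    have hterm : ∀ m ∈ (Icc 1 ⌊2 * M'⌋₊).filter (fun m => ¬ (Nat.Coprime m n₁ ∧ Nat.Coprime m n₂)),
        ‖polyRootWeylSum f (d * m) k' * (g m : ℂ)‖ ≤ (polyRootCountMod ![f] (n₁ * n₂ * m) : ℝ) := by
      intro m _
      rw [norm_mul, Complex.norm_real, Real.norm_eq_abs]
      calc ‖polyRootWeylSum f (d * m) k'‖ * |g m| ≤ (polyRootCountMod ![f] (d * m) : ℝ) * 1 :=
            mul_le_mul (norm_polyRootWeylSum_le _ _ _) (hg1 _) (abs_nonneg _) (Nat.cast_nonneg _)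
        _ = (polyRootCountMod ![f] (n₁ * n₂ * m) : ℝ) := by rw [mul_one, hdd]
    refine (Finset.sum_le_sum hterm).trans ?_
    -- `{¬coprime} ⊆ {n₁ ∣ m} ∪ {n₂ ∣ m}`
    have hsub : (Icc 1 ⌊2 * M'⌋₊).filter (fun m => ¬ (Nat.Coprime m n₁ ∧ Nat.Coprime m n₂)) ⊆
        (Icc 1 ⌊2 * M'⌋₊).filter (fun m => n₁ ∣ m) ∪ (Icc 1 ⌊2 * M'⌋₊).filter (fun m => n₂ ∣ m) := by
      intro m hm
      rw [Finset.mem_filter] at hm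
      rw [Finset.mem_union, Finset.mem_filter, Finset.mem_filter]
      rcases dvd_or_dvd_of_not_coprime hp₁ hp₂ hm.2 with h1 | h1
      · exact Or.inl ⟨hm.1, h1⟩
      · exact Or.inr ⟨hm.1, h1⟩
    have hE₁ := herr n₁ n₂ hp₁ hp₂ hne (2 * M') (by positivity)
    have hE₂ := herr n₂ n₁ hp₂ hp₁ hne.symm (2 * M') (by positivity)
    have hE₂' : ∑ m ∈ (Icc 1 ⌊2 * M'⌋₊).filter (fun m => n₂ ∣ m),
        (polyRootCountMod ![f] (n₁ * n₂ * m) : ℝ) ≤ Ce * (2 * M') / n₂ := by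
      have : ∀ m : ℕ, n₁ * n₂ * m = n₂ * n₁ * m := fun m => by ring
      simp_rw [this]
      exact hE₂
    calc ∑ m ∈ (Icc 1 ⌊2 * M'⌋₊).filter (fun m => ¬ (Nat.Coprime m n₁ ∧ Nat.Coprime m n₂)),
          (polyRootCountMod ![f] (n₁ * n₂ * m) : ℝ)
        ≤ ∑ m ∈ (Icc 1 ⌊2 * M'⌋₊).filter (fun m => n₁ ∣ m) ∪ (Icc 1 ⌊2 * M'⌋₊).filter (fun m => n₂ ∣ m),
          (polyRootCountMod ![f] (n₁ * n₂ * m) : ℝ) :=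
          Finset.sum_le_sum_of_subset_of_nonneg hsub fun _ _ _ => Nat.cast_nonneg _
      _ ≤ ∑ m ∈ (Icc 1 ⌊2 * M'⌋₊).filter (fun m => n₁ ∣ m), (polyRootCountMod ![f] (n₁ * n₂ * m) : ℝ) +
          ∑ m ∈ (Icc 1 ⌊2 * M'⌋₊).filter (fun m => n₂ ∣ m), (polyRootCountMod ![f] (n₁ * n₂ * m) : ℝ) := by
          rw [← Finset.sum_union_inter]
          have : 0 ≤ ∑ m ∈ (Icc 1 ⌊2 * M'⌋₊).filter (fun m => n₁ ∣ m) ∩ (Icc 1 ⌊2 * M'⌋₊).filter (fun m => n₂ ∣ m),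
              (polyRootCountMod ![f] (n₁ * n₂ * m) : ℝ) := Finset.sum_nonneg fun _ _ => Nat.cast_nonneg _
          linarith
      _ ≤ Ce * (2 * M') / n₁ + Ce * (2 * M') / n₂ := add_le_add hE₁ hE₂'
      _ = 2 * Ce * (M' / n₁ + M' / n₂) := by ring
  -- assemble
  have hK₁ : K₂₅ ≤ max K₂₅ (2 * Ce) := le_max_left _ _
  have hK₂ : 2 * Ce ≤ max K₂₅ (2 * Ce) := le_max_right _ _
  have hT0 : 0 ≤ ((Nat.divisors (k * d)).card : ℝ) ^ (3 / 2 : ℝ) * (Nat.gcd k d : ℝ) ^ (1 / 4 : ℝ) *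
      (d : ℝ) ^ (1 / 4 : ℝ) * M' ^ (3 / 4 : ℝ) * Real.log (2 * M') := by
    have : 0 ≤ Real.log (2 * M') := Real.log_nonneg (by linarith)
    positivity
  have hE0 : 0 ≤ M' / n₁ + M' / n₂ := by positivity
  calc ‖∑ m ∈ Icc 1 ⌊2 * M'⌋₊, polyRootWeylSum f (d * m) k' * (g m : ℂ)‖ +
        ‖∑ m ∈ (Icc 1 ⌊2 * M'⌋₊).filter (fun m => ¬ (Nat.Coprime m n₁ ∧ Nat.Coprime m n₂)),
          polyRootWeylSum f (d * m) k' * (g m : ℂ)‖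
      ≤ K₂₅ * ((Nat.divisors (k * d)).card : ℝ) ^ (3 / 2 : ℝ) * (Nat.gcd k d : ℝ) ^ (1 / 4 : ℝ) *
          (d : ℝ) ^ (1 / 4 : ℝ) * M' ^ (3 / 4 : ℝ) * Real.log (2 * M') + 2 * Ce * (M' / n₁ + M' / n₂) :=
        add_le_add hfull herr'
    _ = K₂₅ * (((Nat.divisors (k * d)).card : ℝ) ^ (3 / 2 : ℝ) * (Nat.gcd k d : ℝ) ^ (1 / 4 : ℝ) *
          (d : ℝ) ^ (1 / 4 : ℝ) * M' ^ (3 / 4 : ℝ) * Real.log (2 * M')) + 2 * Ce * (M' / n₁ + M' / n₂) := by ring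
    _ ≤ max K₂₅ (2 * Ce) * (((Nat.divisors (k * d)).card : ℝ) ^ (3 / 2 : ℝ) * (Nat.gcd k d : ℝ) ^ (1 / 4 : ℝ) *
          (d : ℝ) ^ (1 / 4 : ℝ) * M' ^ (3 / 4 : ℝ) * Real.log (2 * M')) +
          max K₂₅ (2 * Ce) * (M' / n₁ + M' / n₂) :=
        add_le_add (mul_le_mul_of_nonneg_right hK₁ hT0) (mul_le_mul_of_nonneg_right hK₂ hE0)
    _ = _ := by rw [hdd]; push_cast; ring

end DFI1995

end Literature.NumberTheory.Sieve
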